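/-
Copyright (c) 2026 the pub-hodgecm-mathlib formalisation cell (harness21).  Prover seat hodgecm-mathlib-F0P3a-p04 (g12), (F12) «type-(1) values-abstract
assembly» of MAP v3 (architect A-p06 (g26), SPEC-F12 (S2)+(S4)); LEAD F0P3a-plan (g9) WORD T8-51 (C) (line «N7nsCount», `stub_countSplitClause`), 2026-09-01.
-/
import Literature.NumberTheory.Rogawski1990.UnitFundamentalLemmaInertIrredClauseOfValues     -- ★ p840832 (B-p14, F11-e): the type-(2) pattern + the two support lemmas reused here
import Literature.NumberTheory.Rogawski1990.LocalStableClassesNonsplitKappaCount            -- ★ p840588 (F0P3-p02): `κ_v` a class function; over ★ p840101 (B-p04): FOUR classes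
import HarnessLib

/-!
# The (P3)-split clause of the inert unit fundamental lemma FROM THE FIVE VALUES — head shape of `stub_countSplitClause`
# (Flicker 1998, Prop. 3 p. 78, Theorem 15 p. 96: `Δ_{G∕H}(t)·(Φ(t₁) + Φ(t₂) − Φ(t₃) − Φ(t₄)) = Φ^st_H(t)`; Rogawski 1990, Prop. 4.9.1 (b), (4.3.1)–(4.3.2))

Topic `NumberTheory/Rogawski1990`; namespace `Literature.NumberTheory.Rogawski1990`.  THEOREMS ONLY (no definition, no instance, no notation, no named fact,
no `sorry`).  Cell `pub/hodgecm-mathlib`, crux H413 = `stmt-HodgeConjecture-24833`, P3a road «D-N7-inert», MAP v3 brick **(F12)**, the TYPE-(1) twin of ★ B-p14's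
(F11-e) `UnitFundamentalLemmaInertIrredClauseOfValues`: the ASSEMBLY SHAPE of the line «N7nsCount» stub `stub_countSplitClause` (torus `T ≃ (E¹)³`), with the four
`G′`-side orbital-integral VALUES and the `H`-side stable value as hypotheses («values-abstract assembly», architect A-p06 2026-09-01 04:15:50Z).

THE MATHEMATICS.  At a finite place `v` of `L⁺` non-split and unramified in the CM field `L` (`w ∣ v`, `q_v = #k_v`), let `ι_v(γ_H) ↔ t₁` be a matching pair
(`γ_H = (g, u) ∈ H_v = U(Φ₂) × U(Φ₁)`, `t₁ ∈ G′_v = U(H′_v)`, `χ_g(u)` a unit) with `t₁` of TYPE (1): a diagonalising frame `t₁ P = P · diag(u′)` with `u′`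
injective and norm-one entries (torus `(E¹)³`).  Then the local stable class of `t₁` consists of FOUR `G′_v`-classes (★ `ncard_conjClassesIn_eq_four`,
[Rogawski1990, Prop. 3.5.2 (c): `𝓔(T∕F_v) ≅ {ε ∈ (ℤ∕2)³ : Σε = 0}`]; Flicker's `t₁, t₂, t₃, t₄` [Flicker1998UnitaryFL, Prop. 3 p. 78]), on which `κ_v(γ_H, ·) = ±1`
takes each sign twice (★ `LocalStableClassesNonsplitKappaCount`).  So if `t₁, t₂, t₃, t₄` are matched representatives, `t₁ ≁ t₂`, `t₃ ≁ t₄`, with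
`κ_v(γ_H, t₁) = κ_v(γ_H, t₂) = 1` and `κ_v(γ_H, t₃) = κ_v(γ_H, t₄) = −1`, their classes ARE the stable class, `Δ‴_v(γ_H, ·)` is supported on them
(★ `mk_mem_conjClassesIn_of_finExplicitDelta_ne_zero`) and equals `Z · κ_v(γ_H, ·)` there, `Z = (−q_v)^{−ord_w χ_g(u)}`
(★ (D2) `finExplicitDelta_eq_neg_absNorm_zpow_mul_kappa_of_nonsplit_of_isUnramifiedIn`).  Hence, for ANY test function `f` and ANY orbital-measure family,
`∑ᶠ c, Δ‴_v(γ_H, out c)·Φ(c, f) = Z·(Φ(⟦t₁⟧, f) + Φ(⟦t₂⟧, f) − Φ(⟦t₃⟧, f) − Φ(⟦t₄⟧, f))` (**`finsum_delta_mul_classOrbitalIntegral_eq_of_four_classes_of_values`**,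
read through the values `Φ(⟦tᵢ⟧, f) = Xᵢ`), and the clause `Φ^st(γ_H, f^H) = ∑ᶠ c, Δ‴_v(γ_H, out c)·Φ(c, f)` FOLLOWS FROM THE FIVE VALUES `X₁ … X₄`,
`Y = Φ^st(γ_H, f^H)` and the one line of algebra `Z·(X₁ + X₂ − X₃ − X₄) = Y` (**`stableOrbitalIntegralRel_eq_finsum_delta_of_four_classes_of_values`**) — for
`f = 1_{K′}`, `f^H = 1_{K_H}` this algebra is Flicker's THEOREM 15 (★ `flicker_theorem15_div`) with, in Flicker's labels (A-p03 2026-09-01 04:07:45Z, certified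
against ★ `flicker_theorem15` on 102 triples): `X₁ = Φ(t₁) = phiZero q N₁ N₂ N` (`ε = 000`, `κ = +`), `X₂ = Φ(t₂) = phiOne q N₁ N` (`κ = +`), `X₃ = Φ(t₃) = phiOne q N N₁`,
`X₄ = Φ(t₄) = phiOne q N₁ N₂` (`κ = −`), `Y = phiH q N`, `Z = (−q)^{−(N₁+N₂)}` (SPEC-F12 (S0-D2), (S1), (S2)(iii), (S3)).  The frame of `t₁` enters ONLY through the
class count; the signs are INPUT (no eigenvalue bookkeeping `u′_j = u` here — that is the `κ`-rider's job upstream).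
HONEST LABEL: HC_CM is proved only modulo the printed citations until rung 0 closes; this file proves the bookkeeping, not the counts.

## References
* [Flicker1998UnitaryFL] Y. Z. Flicker, *Elementary proof of the fundamental lemma for a unitary group*, Canad. J. Math. 50 (1998), Prop. 3 p. 78, §6 p. 95,
  Theorem 15 p. 96.
* [Rogawski1990] J. D. Rogawski, *Automorphic Representations of Unitary Groups in Three Variables*, Ann. of Math. Stud. 123 (1990), §3.5 Prop. 3.5.2 (c) p. 29,
  §3.6 p. 31, §4.3 (4.3.1)–(4.3.2) p. 43, §4.9 Prop. 4.9.1 (b) p. 55.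
* [Kottwitz1986] R. E. Kottwitz, *Stable trace formula: elliptic singular terms*, Math. Ann. 275 (1986), §7.
-/

set_option autoImplicit false

noncomputable section

open NumberField IsDedekindDomain Matrix
open scoped MatrixGroups

namespace Literature.NumberTheory.Rogawski1990

open Literature.NumberTheory.Automorphic Literature.NumberTheory.Automorphic.UnitaryGroup
open Literature.NumberTheory.GaloisRepresentations Literature.NumberTheory.NumberFields Literature.NumberTheory.QuadraticForms
open Literature.AlgebraicGeometry.ShimuraVarieties (unitaryGroup mem_unitaryGroup_iff)

section Clause

variable (L : Type) [Field L] [NumberField L] [IsCMField L] (v : HeightOneSpectrum (𝓞 ↥(maximalRealSubfield L)))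
  (H' : Matrix (Fin 3) (Fin 3) L)
  (a : (UnitaryGroup.cmDatum L 2 (Matrix.of fun i j : Fin 2 => if i.val + j.val + 1 = 2 then (1 : L) else 0)).Local v ×
      (UnitaryGroup.cmDatum L 1 (Matrix.of fun i j : Fin 1 => if i.val + j.val + 1 = 1 then (1 : L) else 0)).Local v)
  (w : UnitaryGroup.PlacesOver L v) (hw : IsCMField.complexConj L • w.1 = w.1)

/-- A CM field has a non-zero element negated by complex conjugation (`ζ − ζ̄` for any `ζ` moved by `c ≠ 1`; the `δ` of the `E∕F`-generic class count).
[cite: Rogawski1990, §1.10] -/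
private theorem exists_complexConj_eq_neg_ne_zero''' (L : Type) [Field L] [NumberField L] [IsCMField L] :
    ∃ δ : L, IsCMField.complexConj L δ = -δ ∧ δ ≠ 0 := by
  obtain ⟨ζ, hζ⟩ := not_forall.1 fun h0 => IsCMField.complexConj_ne_one L (AlgEquiv.ext h0)
  refine ⟨ζ - IsCMField.complexConj L ζ, by rw [map_sub, IsCMField.complexConj_apply_apply, neg_sub], fun h0 => hζ ?_⟩
  rw [sub_eq_zero] at h0
  exact h0.symm

/-- Matched elements lie in one local stable class: `ι_v(γ_H) ↔ t₁` and `ι_v(γ_H) ↔ δ` give `⟦δ⟧ ∈ conjClassesIn t₁`. [cite: Rogawski1990, §4.3 p. 43] -/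
theorem mk_mem_conjClassesIn_of_isLocalNormPair {t₁ δ : (UnitaryGroup.cmDatum L 3 H').Local v} (h₁ : IsLocalNormPair L H' v a t₁)
    (hδ : IsLocalNormPair L H' v a δ) :
    ConjClasses.mk (⟨δ.val, δ.2⟩ : unitaryGroup (UnitaryGroup.conjLocal L (IsCMField.complexConj L) v)
        ((UnitaryGroup.adelicForm L 3 H').map (UnitaryGroup.adeleToLocal L v))) ∈
      conjClassesIn (UnitaryGroup.conjLocal L (IsCMField.complexConj L) v)
        ((UnitaryGroup.adelicForm L 3 H').map (UnitaryGroup.adeleToLocal L v)) ⟨t₁.val, t₁.2⟩ := by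
  rw [isLocalNormPair_iff] at h₁ hδ
  exact mk_mem_conjClassesIn_iff.2 (h₁.isStablyConj_right hδ)

/-- Matched elements with DIFFERENT signs `κ_v(γ_H, ·)` are not conjugate, i.e. have different classes. [cite: Rogawski1990, §4.3 (4.3.2) p. 43] -/
theorem mk_ne_mk_of_finKappaAt_ne {t t' : (UnitaryGroup.cmDatum L 3 H').Local v} (h : IsLocalNormPair L H' v a t)
    (hκ : finKappaAt L v H' a t ≠ finKappaAt L v H' a t') : ConjClasses.mk t ≠ ConjClasses.mk t' := fun hmk =>
  hκ (finKappaAt_eq_of_isConj L v H' a t h (ConjClasses.mk_eq_mk_iff_isConj.1 hmk)).symm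

include hw in
open scoped Classical in
/-- **THE `G′`-SIDE OF THE CLAUSE ON A TYPE-(1) STABLE CLASS, FROM FOUR REPRESENTATIVES: `∑ᶠ c, Δ‴_v(γ_H, out c)·Φ(c, f) = Z·(X₁ + X₂ − X₃ − X₄)`**,
`Z = (−q_v)^{−ord_w χ_g(u)}`.  Here `t₁, t₂, t₃, t₄ ∈ G′_v` are matched with `ι_v(γ_H)`, `t₁` has a type-(1) eigenframe (`t₁P = P·diag(u′)`, `u′` injective with
norm-one entries — used only to COUNT the stable class: four classes, ★ `ncard_conjClassesIn_eq_four`), `t₁ ≁ t₂`, `t₃ ≁ t₄`, `κ_v(γ_H, t₁) = κ_v(γ_H, t₂) = 1`,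
`κ_v(γ_H, t₃) = κ_v(γ_H, t₄) = −1`, and `Xᵢ = Φ(⟦tᵢ⟧, f)` (any `f`, any orbital-measure family).  Flicker's `Φ^κ_f(t) = Φ(t₁) + Φ(t₂) − Φ(t₃) − Φ(t₄)` [p. 95].
[cite: Rogawski1990, §4.3 (4.3.1)–(4.3.2) p. 43; §4.9 Prop. 4.9.1 (b) p. 55; §3.5 Prop. 3.5.2 (c) p. 29] [cite: Flicker1998UnitaryFL, Prop. 3 p. 78; §6 p. 95] -/
theorem finsum_delta_mul_classOrbitalIntegral_eq_of_four_classes_of_values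
    [∀ γ : (UnitaryGroup.cmDatum L 3 H').Local v,
    MeasurableSpace (((UnitaryGroup.cmDatum L 3 H').Local v) ⧸ Subgroup.centralizer ({γ} : Set ((UnitaryGroup.cmDatum L 3 H').Local v)))]
    (μ : HeckeCharacter L)
    (hμω : ∀ x : ideleGroup ↥(maximalRealSubfield L), μ (AdeleRing.ideleBaseChange ↥(maximalRealSubfield L) L x) = quadraticHeckeCharCM L x)
    (hunr : Algebra.IsUnramifiedIn (𝓞 L) v.asIdeal) (hμ : μ.IsUnramifiedAt w.1)
    (hl : ∀ (v : HeightOneSpectrum (𝓞 ↥(maximalRealSubfield L)))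
      (a : (UnitaryGroup.cmDatum L 2 (Matrix.of fun i j : Fin 2 => if i.val + j.val + 1 = 2 then (1 : L) else 0)).Local v ×
      (UnitaryGroup.cmDatum L 1 (Matrix.of fun i j : Fin 1 => if i.val + j.val + 1 = 1 then (1 : L) else 0)).Local v)
      (b : (UnitaryGroup.cmDatum L 3 H').Local v)
      (x : (UnitaryGroup.cmDatum L 2 (Matrix.of fun i j : Fin 2 => if i.val + j.val + 1 = 2 then (1 : L) else 0)).Local v ×
      (UnitaryGroup.cmDatum L 1 (Matrix.of fun i j : Fin 1 => if i.val + j.val + 1 = 1 then (1 : L) else 0)).Local v),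
      finExplicitDelta L v H' (x * a * x⁻¹) μ b = finExplicitDelta L v H' a μ b)
    (hr : ∀ (v : HeightOneSpectrum (𝓞 ↥(maximalRealSubfield L)))
      (a : (UnitaryGroup.cmDatum L 2 (Matrix.of fun i j : Fin 2 => if i.val + j.val + 1 = 2 then (1 : L) else 0)).Local v ×
      (UnitaryGroup.cmDatum L 1 (Matrix.of fun i j : Fin 1 => if i.val + j.val + 1 = 1 then (1 : L) else 0)).Local v)
      (b y : (UnitaryGroup.cmDatum L 3 H').Local v),
      finExplicitDelta L v H' a μ (y * b * y⁻¹) = finExplicitDelta L v H' a μ b)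
    {t₁ t₂ t₃ t₄ : (UnitaryGroup.cmDatum L 3 H').Local v}
    (h₁ : IsLocalNormPair L H' v a t₁) (h₂ : IsLocalNormPair L H' v a t₂) (h₃ : IsLocalNormPair L H' v a t₃) (h₄ : IsLocalNormPair L H' v a t₄)
    (hu : IsUnit ((finCharpolyTwo L v a).eval (finGammaTwo L v a)))
    (hH : (((UnitaryGroup.adelicForm L 3 H').map (UnitaryGroup.adeleToLocal L v)).map
      (UnitaryGroup.conjLocal L (IsCMField.complexConj L) v))ᵀ = (UnitaryGroup.adelicForm L 3 H').map (UnitaryGroup.adeleToLocal L v))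
    (hHd : IsUnit ((UnitaryGroup.adelicForm L 3 H').map (UnitaryGroup.adeleToLocal L v)).det)
    {P : GL (Fin 3) (UnitaryGroup.LocalRing L v)} {u' : Fin 3 → UnitaryGroup.LocalRing L v}
    (hP : (t₁.val.val : Matrix (Fin 3) (Fin 3) (UnitaryGroup.LocalRing L v)) * P.val = P.val * diagonal u')
    (hu' : Function.Injective u') (hu'1 : ∀ i, UnitaryGroup.conjLocal L (IsCMField.complexConj L) v (u' i) * u' i = 1)
    (h12 : ¬ IsConj t₁ t₂) (h34 : ¬ IsConj t₃ t₄)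
    (hκ₁ : finKappaAt L v H' a t₁ = 1) (hκ₂ : finKappaAt L v H' a t₂ = 1) (hκ₃ : finKappaAt L v H' a t₃ = -1) (hκ₄ : finKappaAt L v H' a t₄ = -1)
    (mG : OrbitalMeasureFamily ((UnitaryGroup.cmDatum L 3 H').Local v)) (f : (UnitaryGroup.cmDatum L 3 H').Local v → ℂ) {X₁ X₂ X₃ X₄ : ℂ}
    (hΦ₁ : classOrbitalIntegral mG f (ConjClasses.mk t₁) = X₁) (hΦ₂ : classOrbitalIntegral mG f (ConjClasses.mk t₂) = X₂)
    (hΦ₃ : classOrbitalIntegral mG f (ConjClasses.mk t₃) = X₃) (hΦ₄ : classOrbitalIntegral mG f (ConjClasses.mk t₄) = X₄) :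
    ∑ᶠ c : ConjClasses ((UnitaryGroup.cmDatum L 3 H').Local v),
        (finExplicitCollection L H' μ hl hr v).Δ a (Quotient.out c) * classOrbitalIntegral mG f c =
      (-(Ideal.absNorm v.asIdeal : ℂ)) ^ WithZero.log (Valued.v (((finCharpolyTwo L v a).eval (finGammaTwo L v a)) w)) * (X₁ + X₂ - X₃ - X₄) := by
  set Z : ℂ := (-(Ideal.absNorm v.asIdeal : ℂ)) ^ WithZero.log (Valued.v (((finCharpolyTwo L v a).eval (finGammaTwo L v a)) w)) with hZ
  set F : ConjClasses ((UnitaryGroup.cmDatum L 3 H').Local v) → ℂ :=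
    fun c => (finExplicitCollection L H' μ hl hr v).Δ a (Quotient.out c) * classOrbitalIntegral mG f c with hF
  -- the stable class of `t₁`: four classes, finite
  obtain ⟨δ₁, hcδ, hδ⟩ := exists_complexConj_eq_neg_ne_zero''' L
  have hS4 := ncard_conjClassesIn_eq_four L v (IsCMField.complexConj L) hcδ hδ w hw hH hHd t₁.2 hP hu' hu'1
  have hSfin := finite_conjClassesIn_of_eigenframe L v (IsCMField.complexConj L) hcδ hδ w hw hH hHd t₁.2 hP hu' hu'1
  -- every class reads as `⟦out c⟧` (on the ★ `unitaryGroup` carrier of ★ `conjClassesIn`)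
  have hmk : ∀ c : ConjClasses ((UnitaryGroup.cmDatum L 3 H').Local v),
      ConjClasses.mk (⟨(Quotient.out c).val, (Quotient.out c).2⟩ : unitaryGroup (UnitaryGroup.conjLocal L (IsCMField.complexConj L) v)
        ((UnitaryGroup.adelicForm L 3 H').map (UnitaryGroup.adeleToLocal L v))) = c := fun c => Quotient.out_eq c
  -- the four classes are pairwise distinct …
  have n12 : ConjClasses.mk t₁ ≠ ConjClasses.mk t₂ := fun h0 => h12 (ConjClasses.mk_eq_mk_iff_isConj.1 h0)
  have n34 : ConjClasses.mk t₃ ≠ ConjClasses.mk t₄ := fun h0 => h34 (ConjClasses.mk_eq_mk_iff_isConj.1 h0)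
  have n13 : ConjClasses.mk t₁ ≠ ConjClasses.mk t₃ := mk_ne_mk_of_finKappaAt_ne L v H' a h₁ (by rw [hκ₁, hκ₃]; norm_num)
  have n14 : ConjClasses.mk t₁ ≠ ConjClasses.mk t₄ := mk_ne_mk_of_finKappaAt_ne L v H' a h₁ (by rw [hκ₁, hκ₄]; norm_num)
  have n23 : ConjClasses.mk t₂ ≠ ConjClasses.mk t₃ := mk_ne_mk_of_finKappaAt_ne L v H' a h₂ (by rw [hκ₂, hκ₃]; norm_num)
  have n24 : ConjClasses.mk t₂ ≠ ConjClasses.mk t₄ := mk_ne_mk_of_finKappaAt_ne L v H' a h₂ (by rw [hκ₂, hκ₄]; norm_num)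
  -- … lie in the stable class of `t₁` …
  have hsub : ({ConjClasses.mk t₁, ConjClasses.mk t₂, ConjClasses.mk t₃, ConjClasses.mk t₄} : Set (ConjClasses ((UnitaryGroup.cmDatum L 3 H').Local v))) ⊆
      conjClassesIn (UnitaryGroup.conjLocal L (IsCMField.complexConj L) v)
        ((UnitaryGroup.adelicForm L 3 H').map (UnitaryGroup.adeleToLocal L v)) ⟨t₁.val, t₁.2⟩ := by
    intro x hx
    simp only [Set.mem_insert_iff, Set.mem_singleton_iff] at hx
    rcases hx with rfl | rfl | rfl | rfl
    · exact mk_mem_conjClassesIn_of_isLocalNormPair L v H' a h₁ h₁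
    · exact mk_mem_conjClassesIn_of_isLocalNormPair L v H' a h₁ h₂
    · exact mk_mem_conjClassesIn_of_isLocalNormPair L v H' a h₁ h₃
    · exact mk_mem_conjClassesIn_of_isLocalNormPair L v H' a h₁ h₄
  -- … and so they ARE the stable class
  have h4 : ({ConjClasses.mk t₁, ConjClasses.mk t₂, ConjClasses.mk t₃, ConjClasses.mk t₄} : Set (ConjClasses ((UnitaryGroup.cmDatum L 3 H').Local v))).ncard = 4 := by
    have hn1 : ConjClasses.mk t₁ ∉ ({ConjClasses.mk t₂, ConjClasses.mk t₃, ConjClasses.mk t₄} : Set (ConjClasses ((UnitaryGroup.cmDatum L 3 H').Local v))) := by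
      simp only [Set.mem_insert_iff, Set.mem_singleton_iff, not_or]; exact ⟨n12, n13, n14⟩
    have hn2 : ConjClasses.mk t₂ ∉ ({ConjClasses.mk t₃, ConjClasses.mk t₄} : Set (ConjClasses ((UnitaryGroup.cmDatum L 3 H').Local v))) := by
      simp only [Set.mem_insert_iff, Set.mem_singleton_iff, not_or]; exact ⟨n23, n24⟩
    rw [Set.ncard_insert_of_notMem hn1 (Set.toFinite _), Set.ncard_insert_of_notMem hn2 (Set.toFinite _), Set.ncard_pair n34]
  have heq := Set.eq_of_subset_of_ncard_le hsub (Nat.le_of_eq (hS4.trans h4.symm)) hSfin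
  -- support inside the four
  have hsupp : Function.support F ⊆ ({ConjClasses.mk t₁, ConjClasses.mk t₂, ConjClasses.mk t₃, ConjClasses.mk t₄} :
      Set (ConjClasses ((UnitaryGroup.cmDatum L 3 H').Local v))) := by
    intro c hc
    rw [Function.mem_support] at hc
    have hΔ : finExplicitDelta L v H' a μ (Quotient.out c) ≠ 0 := by
      intro h0
      apply hc
      simp only [hF, finExplicitCollection_Δ, h0, zero_mul]
    have hmem := mk_mem_conjClassesIn_of_finExplicitDelta_ne_zero L v H' a t₁ μ h₁ hΔ
    rwa [hmk, ← heq] at hmem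
  rw [← finsum_mem_univ, finsum_mem_inter_support_eq' F Set.univ
    ({ConjClasses.mk t₁, ConjClasses.mk t₂, ConjClasses.mk t₃, ConjClasses.mk t₄} : Set (ConjClasses ((UnitaryGroup.cmDatum L 3 H').Local v)))
    (fun x hx => ⟨fun _ => hsupp hx, fun _ => Set.mem_univ _⟩)]
  have hn1 : ConjClasses.mk t₁ ∉ ({ConjClasses.mk t₂, ConjClasses.mk t₃, ConjClasses.mk t₄} : Set (ConjClasses ((UnitaryGroup.cmDatum L 3 H').Local v))) := by
    simp only [Set.mem_insert_iff, Set.mem_singleton_iff, not_or]; exact ⟨n12, n13, n14⟩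
  have hn2 : ConjClasses.mk t₂ ∉ ({ConjClasses.mk t₃, ConjClasses.mk t₄} : Set (ConjClasses ((UnitaryGroup.cmDatum L 3 H').Local v))) := by
    simp only [Set.mem_insert_iff, Set.mem_singleton_iff, not_or]; exact ⟨n23, n24⟩
  rw [finsum_mem_insert F hn1 (Set.toFinite _), finsum_mem_insert F hn2 (Set.toFinite _), finsum_mem_pair n34]
  -- the chosen representative of `⟦t⟧` is matched (`G′_v`-conjugate to `t`, ★ `isLocalNormPair_conj_right`)
  have hmk' : ∀ c : ConjClasses ((UnitaryGroup.cmDatum L 3 H').Local v), ConjClasses.mk (Quotient.out c) = c := fun c => Quotient.out_eq c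
  have hout : ∀ {t : (UnitaryGroup.cmDatum L 3 H').Local v}, IsLocalNormPair L H' v a t → IsLocalNormPair L H' v a (Quotient.out (ConjClasses.mk t)) := by
    intro t ht
    obtain ⟨c, hc⟩ := isConj_iff.1 (ConjClasses.mk_eq_mk_iff_isConj.1 (hmk' (ConjClasses.mk t)).symm)
    rw [← hc]
    exact (isLocalNormPair_conj_right L v H' a t (c : (UnitaryGroup.cmDatum L 3 H').Local v)).2 ht
  -- the value of `Δ‴` at the representative of `⟦t⟧`: `Δ‴(γ_H, out ⟦t⟧) = Z · κ_v(γ_H, t)` (★ (D2); `κ_v` a class function)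
  have hval : ∀ {t : (UnitaryGroup.cmDatum L 3 H').Local v}, IsLocalNormPair L H' v a t →
      (finExplicitCollection L H' μ hl hr v).Δ a (Quotient.out (ConjClasses.mk t)) = Z * ((finKappaAt L v H' a t : ℤ) : ℂ) := by
    intro t ht
    rw [finExplicitCollection_Δ, finExplicitDelta_eq_neg_absNorm_zpow_mul_kappa_of_nonsplit_of_isUnramifiedIn L v H' a _ w hw μ hμω hunr hμ (hout ht) hu,
      finKappaAt_out_mk L v H' a t ht]
  simp only [hF]
  rw [hval h₁, hval h₂, hval h₃, hval h₄, hκ₁, hκ₂, hκ₃, hκ₄, hΦ₁, hΦ₂, hΦ₃, hΦ₄]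
  push_cast
  ring

include hw in
open scoped Classical in
/-- **`stub_countSplitClause` FROM THE FIVE VALUES** (the assembly shape of MAP v3 (F12), SPEC-F12 (S4)).  In the frame of the previous theorem, the clause
`Φ^st(γ_H, f^H) = ∑ᶠ c, Δ‴_v(γ_H, out c)·Φ(c, f)` holds as soon as the five values `Xᵢ = Φ(⟦tᵢ⟧, f)` (`i = 1 … 4`) and `Y = Φ^st(γ_H, f^H)` satisfy
`Z·(X₁ + X₂ − X₃ − X₄) = Y`, `Z = (−q_v)^{−ord_w χ_g(u)}` — for `f = 1_{K′}`, `f^H = 1_{K_H}` exactly Flicker's THEOREM 15 `Δ_{G∕H}(t)·Φ^κ_{1_K}(t) = Φ^st_{1_{K_H}}(t)`,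
`Φ^κ = Φ(t₁) + Φ(t₂) − Φ(t₃) − Φ(t₄)`, i.e. `((−q)^{N₁+N₂})⁻¹·phiKappa q N₁ N₂ N = phiH q N` (★ `flicker_theorem15_div`).
[cite: Flicker1998UnitaryFL, Theorem 15 p. 96; §6 p. 95] [cite: Rogawski1990, §4.9 Prop. 4.9.1 (b) p. 55; §4.3 (4.3.1) p. 43] -/
theorem stableOrbitalIntegralRel_eq_finsum_delta_of_four_classes_of_values
    [∀ γ : (UnitaryGroup.cmDatum L 3 H').Local v,
    MeasurableSpace (((UnitaryGroup.cmDatum L 3 H').Local v) ⧸ Subgroup.centralizer ({γ} : Set ((UnitaryGroup.cmDatum L 3 H').Local v)))]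
    [∀ x : (UnitaryGroup.cmDatum L 2 (Matrix.of fun i j : Fin 2 => if i.val + j.val + 1 = 2 then (1 : L) else 0)).Local v ×
      (UnitaryGroup.cmDatum L 1 (Matrix.of fun i j : Fin 1 => if i.val + j.val + 1 = 1 then (1 : L) else 0)).Local v,
    MeasurableSpace (((UnitaryGroup.cmDatum L 2 (Matrix.of fun i j : Fin 2 => if i.val + j.val + 1 = 2 then (1 : L) else 0)).Local v ×
      (UnitaryGroup.cmDatum L 1 (Matrix.of fun i j : Fin 1 => if i.val + j.val + 1 = 1 then (1 : L) else 0)).Local v) ⧸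
      Subgroup.centralizer ({x} : Set ((UnitaryGroup.cmDatum L 2 (Matrix.of fun i j : Fin 2 => if i.val + j.val + 1 = 2 then (1 : L) else 0)).Local v ×
      (UnitaryGroup.cmDatum L 1 (Matrix.of fun i j : Fin 1 => if i.val + j.val + 1 = 1 then (1 : L) else 0)).Local v)))]
    (μ : HeckeCharacter L)
    (hμω : ∀ x : ideleGroup ↥(maximalRealSubfield L), μ (AdeleRing.ideleBaseChange ↥(maximalRealSubfield L) L x) = quadraticHeckeCharCM L x)
    (hunr : Algebra.IsUnramifiedIn (𝓞 L) v.asIdeal) (hμ : μ.IsUnramifiedAt w.1)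
    (hl : ∀ (v : HeightOneSpectrum (𝓞 ↥(maximalRealSubfield L)))
      (a : (UnitaryGroup.cmDatum L 2 (Matrix.of fun i j : Fin 2 => if i.val + j.val + 1 = 2 then (1 : L) else 0)).Local v ×
      (UnitaryGroup.cmDatum L 1 (Matrix.of fun i j : Fin 1 => if i.val + j.val + 1 = 1 then (1 : L) else 0)).Local v)
      (b : (UnitaryGroup.cmDatum L 3 H').Local v)
      (x : (UnitaryGroup.cmDatum L 2 (Matrix.of fun i j : Fin 2 => if i.val + j.val + 1 = 2 then (1 : L) else 0)).Local v ×
      (UnitaryGroup.cmDatum L 1 (Matrix.of fun i j : Fin 1 => if i.val + j.val + 1 = 1 then (1 : L) else 0)).Local v),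
      finExplicitDelta L v H' (x * a * x⁻¹) μ b = finExplicitDelta L v H' a μ b)
    (hr : ∀ (v : HeightOneSpectrum (𝓞 ↥(maximalRealSubfield L)))
      (a : (UnitaryGroup.cmDatum L 2 (Matrix.of fun i j : Fin 2 => if i.val + j.val + 1 = 2 then (1 : L) else 0)).Local v ×
      (UnitaryGroup.cmDatum L 1 (Matrix.of fun i j : Fin 1 => if i.val + j.val + 1 = 1 then (1 : L) else 0)).Local v)
      (b y : (UnitaryGroup.cmDatum L 3 H').Local v),
      finExplicitDelta L v H' a μ (y * b * y⁻¹) = finExplicitDelta L v H' a μ b)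
    {t₁ t₂ t₃ t₄ : (UnitaryGroup.cmDatum L 3 H').Local v}
    (h₁ : IsLocalNormPair L H' v a t₁) (h₂ : IsLocalNormPair L H' v a t₂) (h₃ : IsLocalNormPair L H' v a t₃) (h₄ : IsLocalNormPair L H' v a t₄)
    (hu : IsUnit ((finCharpolyTwo L v a).eval (finGammaTwo L v a)))
    (hH : (((UnitaryGroup.adelicForm L 3 H').map (UnitaryGroup.adeleToLocal L v)).map
      (UnitaryGroup.conjLocal L (IsCMField.complexConj L) v))ᵀ = (UnitaryGroup.adelicForm L 3 H').map (UnitaryGroup.adeleToLocal L v))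
    (hHd : IsUnit ((UnitaryGroup.adelicForm L 3 H').map (UnitaryGroup.adeleToLocal L v)).det)
    {P : GL (Fin 3) (UnitaryGroup.LocalRing L v)} {u' : Fin 3 → UnitaryGroup.LocalRing L v}
    (hP : (t₁.val.val : Matrix (Fin 3) (Fin 3) (UnitaryGroup.LocalRing L v)) * P.val = P.val * diagonal u')
    (hu' : Function.Injective u') (hu'1 : ∀ i, UnitaryGroup.conjLocal L (IsCMField.complexConj L) v (u' i) * u' i = 1)
    (h12 : ¬ IsConj t₁ t₂) (h34 : ¬ IsConj t₃ t₄)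
    (hκ₁ : finKappaAt L v H' a t₁ = 1) (hκ₂ : finKappaAt L v H' a t₂ = 1) (hκ₃ : finKappaAt L v H' a t₃ = -1) (hκ₄ : finKappaAt L v H' a t₄ = -1)
    (mH : OrbitalMeasureFamily ((UnitaryGroup.cmDatum L 2 (Matrix.of fun i j : Fin 2 => if i.val + j.val + 1 = 2 then (1 : L) else 0)).Local v ×
      (UnitaryGroup.cmDatum L 1 (Matrix.of fun i j : Fin 1 => if i.val + j.val + 1 = 1 then (1 : L) else 0)).Local v))
    (mG : OrbitalMeasureFamily ((UnitaryGroup.cmDatum L 3 H').Local v))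
    (fH : ((UnitaryGroup.cmDatum L 2 (Matrix.of fun i j : Fin 2 => if i.val + j.val + 1 = 2 then (1 : L) else 0)).Local v ×
      (UnitaryGroup.cmDatum L 1 (Matrix.of fun i j : Fin 1 => if i.val + j.val + 1 = 1 then (1 : L) else 0)).Local v) → ℂ)
    (f : (UnitaryGroup.cmDatum L 3 H').Local v → ℂ) {X₁ X₂ X₃ X₄ Y : ℂ}
    (hΦ₁ : classOrbitalIntegral mG f (ConjClasses.mk t₁) = X₁) (hΦ₂ : classOrbitalIntegral mG f (ConjClasses.mk t₂) = X₂)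
    (hΦ₃ : classOrbitalIntegral mG f (ConjClasses.mk t₃) = X₃) (hΦ₄ : classOrbitalIntegral mG f (ConjClasses.mk t₄) = X₄)
    (hΦH : stableOrbitalIntegralRel (IsLocalStablyConjH L v) mH fH a = Y)
    (halg : (-(Ideal.absNorm v.asIdeal : ℂ)) ^ WithZero.log (Valued.v (((finCharpolyTwo L v a).eval (finGammaTwo L v a)) w)) * (X₁ + X₂ - X₃ - X₄) = Y) :
    stableOrbitalIntegralRel (IsLocalStablyConjH L v) mH fH a =
      ∑ᶠ c : ConjClasses ((UnitaryGroup.cmDatum L 3 H').Local v),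
        (finExplicitCollection L H' μ hl hr v).Δ a (Quotient.out c) * classOrbitalIntegral mG f c := by
  rw [hΦH, finsum_delta_mul_classOrbitalIntegral_eq_of_four_classes_of_values L v H' a w hw μ hμω hunr hμ hl hr h₁ h₂ h₃ h₄ hu hH hHd hP hu' hu'1
    h12 h34 hκ₁ hκ₂ hκ₃ hκ₄ mG f hΦ₁ hΦ₂ hΦ₃ hΦ₄, halg]

end Clause

end Literature.NumberTheory.Rogawski1990

end
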